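import Summits.BirchSwinnertonDyer.Rank1Residual.P2.CongruentNumberThetaStarFamily
import HarnessLib
import HarnessLib.Audit.Tags

/-!
# Cell «bsd-monsky» (prover-B): 𝒮⁻-TOWERS — the star family for `q ≡ 3 (mod 4)` (both halves of Monsky's `𝒮⁻`): `n = 2·q·p₁⋯p_m`,
# `pᵢ ≡ 5 (mod 8)` pairwise quadratic residues, EXACTLY one `pᵢ` a non-residue mod `q` (or none if `q ≡ 3 (mod 8)`) ⟹ `𝓛(n)` odd and
# `ord_{s=1} L(E_n, s) = 1` for EVERY `m`, relative to {`tyz_cmPointGaloisData`, TYZ Thm. 1.1} (kernel theorem; nothing asserted, nothing booked)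

HONEST FRAMING (cell `bsd-monsky`, run/shared/lean/pub/bsd-monsky/; README §1/§3): the cell's CLAIMED theorem is Monsky's 1990
conjecture on the `k = 2` family `𝒮⁻ = {2pq : p ≡ 5 (mod 8), q ≡ 3 (mod 4), (p/q) = −1}`; «ℓ ≥ 3 rungs are NOT claimed — record what the
same argument gives there, no more». `P2/CongruentNumberThetaStar{Config,Family,BSD}.lean` did the record UNIFORM IN THE NUMBER OF PRIME
FACTORS for `q ≡ 3 (mod 8)`. THIS FILE adds the half `q ≡ 7 (mod 8)`, so that at `m = 1` the family is ALL of `𝒮⁻` (book230 classes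
`30`, `70`, `174`) and, for every `m`, every pair `(p, q) ∈ 𝒮⁻` TOWERS: adjoining any primes `p₂, …, p_m ≡ 5 (mod 8)` that are quadratic
residues of `q`, of `p` and of each other keeps `ord_{s=1} L(E_{2qpp₂⋯p_m}, s) = 1`. What changes for `q ≡ 7 (mod 8)`: in Li–Ma's Rédei
matrix of `ℚ(√−2qP)` the `q`–`2` entries vanish (`(2/q) = +1`, `−q ≡ 1 (mod 8)`), so the kernel is `{0, 𝟙}` iff there is EXACTLY one
mark (`gBitCfgTwo_star_seven_eq_one`, §1; with no mark `g(n)` is even and `θ` is silent — there Tian–Yuan–Zhang's `Σ₂′` is odd); all the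
other ingredients of `…ThetaStarFamily` (divisors of `P ≡ 1, 5`; `6`-blocks `= 2qz`; `θ`-control; `g`, `𝓛` of even blocks even; the FLAT
certificate) only use `q ≡ 3 (mod 4)` (§2, re-proved under that hypothesis). THEOREM B_∞′ (`odd_scriptL_tower`,
`analyticRank_eq_one_tower_of_cmPointGaloisData`, §4): `q ≡ 3 (mod 4)`, `p₁, …, p_m ≡ 5 (mod 8)` distinct, `(pⱼ/pᵢ) = +1` (`i ≠ j`), at most
one `pᵢ` with `(pᵢ/q) = −1` and at least one unless `q ≡ 3 (mod 8)` ⟹ `𝓛(n)` odd, `ord_{s=1} L(E_n, s) = 1`; clause (b) and the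
Legendre-symbol forms are in `…ThetaStarTowersBSD.lean`. CONTROL (never an input): kit j253031 (PARI; 264 members, `q ∈ {7, 23, 31, 47, 3,
11}`, `m ≤ 4`): for `q ≡ 7 (mod 8)` `Θ = g(n) = [exactly one mark]`, `Σ₂′ = [no mark]` (one-mark members TYZ-SILENT), `s(n) = 1`, analytic
rank `1` on every one-mark member with `n ≤ 1.2·10⁵` (`70, 182, 230, …, 2030, 6670, 8990, …`); 0 alarms
(HOME/proof/j253031-star7-family-control.log). CONDITIONAL on the named facts said; nothing asserted; no count moves; no class booked.
NOT refereed; not part of PROOF-B v1.3 or of the paper.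

References: [TianYuanZhang2017] Thm. 1.1, §3.1 (p0011 L67–L73), Thm. 3.5, Thm. 3.6 (J741), proof of Lemma 3.21 (J759); [LiMa2008]
Lemma 0.1, Def. 0.2, Thm. 0.4; [Monsky1990MockHeegner] p. 67 Remark (3); [IrelandRosen1990] Ch. 5 §1 Prop. 5.1.3, §2 Thm. 1;
[HardyWright2008] §1.3 Thm. 2, §17.8; HOME/proof/PROOF-B-THETA-STAR.md.
-/

noncomputable section

open scoped Classical

open Matrix Finset WeierstrassCurve Literature.NumberTheory.EllipticCurves
  Literature.NumberTheory.EllipticCurves.Rank1Residual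
  Literature.NumberTheory.EllipticCurves.Rank1Residual.Typed
  Literature.NumberTheory.EllipticCurves.HeathBrown1994
  Literature.NumberTheory.EllipticCurves.TianYuanZhang2017
  Literature.NumberTheory.EllipticCurves.TianYuanZhang2017.W2
  Literature.NumberTheory.QuadraticFields.RedeiReichardt

set_option autoImplicit false

namespace Summit.BirchSwinnertonDyer.Rank1Residual.P2

namespace ThetaDescent

variable {m : ℕ} {q : ℕ} {p : Fin m → ℕ}

/-! ## §1 The star configuration with `q ≡ 7 (mod 8)`: `g(2qP)` is odd iff there is EXACTLY one mark -/

/-- **`g(2·q·p₁⋯p_m)` is ODD on the star configuration with `q ≡ 7 (mod 8)` and EXACTLY one mark**, for every `m ≥ 1`. Residues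
`(7, 5, …, 5)`; bits as in `gBitCfgTwo_star_eq_one`. In `RM(−8q∏pᵢ)` the entries `q`–`2` and `2`–`q` now vanish (`(2/q) = +1`,
`[−q ≡ 5 (mod 8)] = 0`), the rest is unchanged: unmarked rows give `v_i = v_2`, the marked row gives `v_q = v_2`, the row of `q` reads
`Σ μ_j (v_q + v_j) = v_q + v_a = 0`; so the kernel is `{0, 𝟙}` and `gBitCfgTwo = 1` (with no mark `v_q` would be free).
[cite: LiMa2008, Thm. 0.4 (p. 280) with Lemma 0.1, Def. 0.2 (p. 279)] [cite: Stevenhagen1995RedeiMatrices, §2 Thm. 1 (l = 2)] -/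
theorem gBitCfgTwo_star_seven_eq_one (r : Fin (m + 1) → ℕ) (hr0 : r 0 = 7) (hrs : ∀ i : Fin m, r i.succ = 5)
    (β : Fin (m + 1) → Fin (m + 1) → ZMod 2) (μ : Fin m → ZMod 2) (h0s : ∀ i : Fin m, β 0 i.succ = μ i)
    (hs0 : ∀ i : Fin m, β i.succ 0 = μ i) (hss : ∀ i j : Fin m, i ≠ j → β i.succ j.succ = 0)
    (hμ : ∀ i j : Fin m, μ i = 1 → μ j = 1 → i = j) {a : Fin m} (ha : μ a = 1) :
    gBitCfgTwo r β = 1 := by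
  have h4 : ¬ (∏ i, r i) % 4 = 1 := by
    rw [Fin.prod_univ_succ, hr0]
    have h5 : ∏ i : Fin m, r i.succ = 5 ^ m := by
      rw [Finset.prod_congr rfl fun i _ => hrs i, Fin.prod_const]
    rw [h5, Nat.mul_mod, Nat.pow_mod]; norm_num
  have hE_sN : ∀ i : Fin m, redeiEntryCfgTwo r β (some i.succ) none = 1 := by
    intro i; simp only [redeiEntryCfgTwo, if_neg h4, add_zero]; rw [hrs i]; decide
  have hE_0s : ∀ i : Fin m, redeiEntryCfgTwo r β (some 0) (some i.succ) = μ i := by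
    intro i
    simp only [redeiEntryCfgTwo, redeiEntryCfg, h0s i, hr0, hrs i]
    simp [chi4Bit]
  have hE_s0 : ∀ i : Fin m, redeiEntryCfgTwo r β (some i.succ) (some 0) = μ i := by
    intro i
    simp only [redeiEntryCfgTwo, redeiEntryCfg, hs0 i, hr0, hrs i]
    simp [chi4Bit]
  have hE_ss : ∀ i j : Fin m, i ≠ j → redeiEntryCfgTwo r β (some i.succ) (some j.succ) = 0 := by
    intro i j hij
    simp only [redeiEntryCfgTwo, redeiEntryCfg, hss i j hij, hrs i, hrs j]
    decide
  have eq_of_add : ∀ x y : ZMod 2, x + y = 0 → x = y := by decide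
  have zmod_cases : ∀ c : ZMod 2, c = 0 ∨ c = 1 := by decide
  have hμ0 : ∀ j, j ≠ a → μ j = 0 := fun j hj => (zmod_cases (μ j)).resolve_right fun h => hj (hμ j a h ha)
  unfold gBitCfgTwo
  rw [if_pos]
  unfold redeiCfgTwo
  apply card_ker_rowsum_eq_two
  intro v hv
  have key_s : ∀ i : Fin m, (v (some i.succ) + v none) + μ i * (v (some i.succ) + v (some 0)) = 0 := by
    intro i
    have h := hv (some i.succ)
    rw [Fintype.sum_option, Fin.sum_univ_succ, hE_sN, hE_s0, one_mul] at h
    have hrest : ∑ j : Fin m, redeiEntryCfgTwo r β (some i.succ) (some j.succ) *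
        (v (some i.succ) + v (some j.succ)) = 0 := by
      refine Finset.sum_eq_zero fun j _ => ?_
      by_cases hji : i = j
      · subst hji; rw [CharTwo.add_self_eq_zero, mul_zero]
      · rw [hE_ss i j hji, zero_mul]
    rw [hrest, add_zero] at h
    exact h
  -- the row of `q`: `c·(v_q + v_2) + Σ_j μ_j (v_q + v_j) = 0`, whatever the `q`–`2` entry `c`
  have key_0 : redeiEntryCfgTwo r β (some 0) none * (v (some 0) + v none) +
      ∑ j : Fin m, μ j * (v (some 0) + v (some j.succ)) = 0 := by
    have h := hv (some 0)
    rw [Fintype.sum_option, Fin.sum_univ_succ, CharTwo.add_self_eq_zero, mul_zero, zero_add] at h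
    simp only [hE_0s] at h
    exact h
  have h0 : v (some 0) = v none := by
    have h := key_s a
    rw [ha, one_mul] at h
    have : ∀ x y z : ZMod 2, x + y + (x + z) = 0 → z = y := by decide
    exact this _ _ _ h
  have hva : v (some a.succ) = v none := by
    have h := key_0
    rw [Finset.sum_eq_single a (fun j _ hj => by rw [hμ0 j hj, zero_mul]) (fun h => absurd (mem_univ a) h), ha,
      one_mul, h0, CharTwo.add_self_eq_zero, mul_zero, zero_add] at h
    exact (eq_of_add _ _ h).symm
  have hs : ∀ i : Fin m, v (some i.succ) = v none := by
    intro i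
    by_cases hia : i = a
    · subst hia; exact hva
    · have h := key_s i
      rw [hμ0 i hia, zero_mul, add_zero] at h
      exact eq_of_add _ _ h
  have hall : ∀ c : Option (Fin (m + 1)), v c = v none := by
    rintro (_ | c)
    · rfl
    · exact Fin.cases (motive := fun c => v (some c) = v none) h0 (fun i => hs i) c
  intro c d
  rw [hall c, hall d]

/-! ## §2 Arithmetic of the star type for `q ≡ 3 (mod 4)` (the statements of `…ThetaStarFamily` §1 under the weaker hypothesis) -/

/-- The prime tuple `(q, p₁, …, p_m)`: all odd (`q ≡ 3 (mod 4)`). [cite: HardyWright2008, §1.3 Thm. 2] -/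
theorem star_cons_odd' (hq4 : q % 4 = 3) (hp5 : ∀ i, p i % 8 = 5) : ∀ i, Odd ((vecCons q p : Fin (m + 1) → ℕ) i) :=
  fun i => Fin.cases (by simpa using Nat.odd_iff.mpr (by omega))
    (fun j => by simpa using Nat.odd_iff.mpr (by have := hp5 j; omega)) i

/-- The prime tuple `(q, p₁, …, p_m)` is injective (`q ≡ 3`, `pᵢ ≡ 1 (mod 4)`). [cite: HardyWright2008, §1.3 Thm. 2] -/
theorem star_cons_injective' (hq4 : q % 4 = 3) (hp5 : ∀ i, p i % 8 = 5) (hinj : Function.Injective p) :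
    Function.Injective (vecCons q p : Fin (m + 1) → ℕ) := by
  have h : Function.Injective (Fin.cons q p : Fin (m + 1) → ℕ) := by
    rw [Fin.cons_injective_iff]
    exact ⟨by rintro ⟨i, hi⟩; have := hp5 i; omega, hinj⟩
  exact h

/-- `n = 2·q·p₁⋯p_m` is square-free (`q ≡ 3 (mod 4)`). [cite: HardyWright2008, §17.8] -/
theorem squarefree_star' (hq : q.Prime) (hq4 : q % 4 = 3) (hp : ∀ i, (p i).Prime) (hp5 : ∀ i, p i % 8 = 5)
    (hinj : Function.Injective p) : Squarefree (2 * (q * ∏ i, p i)) := by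
  rw [← prod_star_cons]
  exact squarefree_two_mul_prod_of_injective _ (star_cons_prime hq hp) (star_cons_odd' hq4 hp5)
    (star_cons_injective' hq4 hp5 hinj)

/-- `n = 2·q·p₁⋯p_m ≡ 6 (mod 8)` for `q ≡ 3 (mod 4)` (`qP ≡ 3, 7`). [cite: HardyWright2008, §5.2 (residues)] -/
theorem star_mod_eight' (hq4 : q % 4 = 3) (hp : ∀ i, (p i).Prime) (hp5 : ∀ i, p i % 8 = 5) (hinj : Function.Injective p) :
    (2 * (q * ∏ i, p i)) % 8 = 6 := by
  have hq' : q % 8 = 3 ∨ q % 8 = 7 := by omega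
  have h : (q * ∏ i, p i) % 8 = 3 ∨ (q * ∏ i, p i) % 8 = 7 := by
    rcases mod_eight_of_dvd_prod_five hp hp5 hinj (dvd_refl _) with h | h <;> rcases hq' with h' | h' <;>
      rw [Nat.mul_mod, h', h] <;> decide
  omega

/-- **The `6`-blocks are the `2qz`, `z ∣ p₁⋯p_m`** (`q ≡ 3 (mod 4)`). [cite: TianYuanZhang2017, §3.1 (p0011 L67–L70)] -/
theorem six_block_star' (hq : q.Prime) (hq4 : q % 4 = 3) (hp : ∀ i, (p i).Prime) (hp5 : ∀ i, p i % 8 = 5)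
    (hinj : Function.Injective p) {e : ℕ} (he : e ∣ 2 * (q * ∏ i, p i)) (he6 : e % 8 = 6) :
    ∃ z : ℕ, z ∣ ∏ i, p i ∧ e = 2 * (q * z) := by
  obtain ⟨y, w, hy, hw, rfl⟩ := Nat.dvd_mul.mp he
  obtain ⟨y', z, hy', hz, rfl⟩ := Nat.dvd_mul.mp hw
  have hz15 := mod_eight_of_dvd_prod_five hp hp5 hinj hz
  have hq' : q % 8 = 3 ∨ q % 8 = 7 := by omega
  have hqz : (q * z) % 8 = 3 ∨ (q * z) % 8 = 7 := by
    rcases hz15 with h | h <;> rcases hq' with h' | h' <;> rw [Nat.mul_mod, h', h] <;> decide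
  rcases (Nat.dvd_prime Nat.prime_two).mp hy with rfl | rfl <;>
    rcases (Nat.dvd_prime hq).mp hy' with rfl | rfl
  · exfalso; omega
  · exfalso; omega
  · exfalso; omega
  · exact ⟨z, hz, rfl⟩

/-- **The star type is `θ`-CONTROLLED** (`q ≡ 3 (mod 4)`): a `5`-divisor of `n` is a product of the `pᵢ ≡ 1 (mod 4)`.
[cite: TianYuanZhang2017, §3.1 (p0011 L67–L70)] -/
theorem thetaControlled_star' (hq : q.Prime) (hq4 : q % 4 = 3) (hp : ∀ i, (p i).Prime) (hp5 : ∀ i, p i % 8 = 5)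
    (hinj : Function.Injective p) :
    ∀ d₀ ∈ (2 * (q * ∏ i, p i)).divisors, d₀ % 8 = 7 → (2 * (q * ∏ i, p i) / d₀) % 8 = 2 →
      ∀ d' ∈ d₀.divisors, d' % 8 = 5 → ∀ r ∈ d'.primeFactors, r % 4 = 1 := by
  intro d₀ hd₀ _ _ d' hd' h5 r hr
  have hd'n : d' ∣ 2 * (q * ∏ i, p i) := (Nat.mem_divisors.mp hd').1.trans (Nat.mem_divisors.mp hd₀).1
  obtain ⟨hrp, hrd, -⟩ := Nat.mem_primeFactors.mp hr
  rcases (Nat.Prime.dvd_mul hrp).mp (hrd.trans hd'n) with h2 | hrest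
  · have h22 := (Nat.prime_dvd_prime_iff_eq hrp Nat.prime_two).mp h2
    subst h22
    omega
  rcases (Nat.Prime.dvd_mul hrp).mp hrest with hrq | hrP
  · have hr1 : r = q := (Nat.prime_dvd_prime_iff_eq hrp hq).mp hrq
    subst hr1
    obtain ⟨e, he⟩ := hrd
    have he2 : e ∣ 2 * ∏ i, p i := by
      have h' : r * e ∣ r * (2 * ∏ i, p i) := by
        rw [← he, show r * (2 * ∏ i, p i) = 2 * (r * ∏ i, p i) by ring]
        exact hd'n
      exact Nat.dvd_of_mul_dvd_mul_left hrp.pos h'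
    have hd'odd : Odd d' := Nat.odd_iff.mpr (by omega)
    have heodd : Odd e := by rw [he] at hd'odd; exact (Nat.odd_mul.mp hd'odd).2
    have heP : e ∣ ∏ i, p i := (Nat.coprime_two_right.mpr heodd).dvd_of_dvd_mul_left he2
    have hq' : r % 8 = 3 ∨ r % 8 = 7 := by omega
    have : d' % 8 = 3 ∨ d' % 8 = 7 := by
      rw [he]
      rcases mod_eight_of_dvd_prod_five hp hp5 hinj heP with h | h <;> rcases hq' with h' | h' <;>
        rw [Nat.mul_mod, h', h] <;> decide
    omega
  · obtain ⟨i, -, hi⟩ := ((Nat.Prime.prime hrp).dvd_finsetProd_iff p).mp hrP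
    rw [(Nat.prime_dvd_prime_iff_eq hrp (hp i)).mp hi]
    have := hp5 i
    omega

/-! ## §3 `g(n)` is ODD on the tower type (`q ≡ 3 (mod 4)`, at most one mark, at least one unless `q ≡ 3 (mod 8)`) -/

/-- **`g(2·q·p₁⋯p_m)` is ODD for `q ≡ 7 (mod 8)` and exactly one mark** (Rédei–Reichardt on the star-seven configuration).
[cite: LiMa2008, Thm. 0.4 (p. 280)] [cite: IrelandRosen1990, Ch. 5 §2 Thm. 1] [cite: TianYuanZhang2017, §1 (p0002 L78–L82: g(d))] -/
theorem odd_gK_star_seven (hq : q.Prime) (hq7 : q % 8 = 7) (hp : ∀ i, (p i).Prime) (hp5 : ∀ i, p i % 8 = 5)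
    (hinj : Function.Injective p) (hQR : ∀ i j, i ≠ j → kroneckerBit (p j) (p i) = 0)
    (hμ : ∀ i j, kroneckerBit (p i) q = 1 → kroneckerBit (p j) q = 1 → i = j) {a : Fin m} (ha : kroneckerBit (p a) q = 1) :
    Odd (gK (2 * (q * ∏ i, p i))) := by
  have hq2 : q ≠ 2 := by omega
  have hq4 : q % 4 = 3 := by omega
  have hP2 : ∀ i, (vecCons q p : Fin (m + 1) → ℕ) i ≠ 2 := fun i h2 => by
    have h := star_cons_odd' (q := q) hq4 hp5 i
    rw [h2] at h
    exact (Nat.not_odd_iff_even.mpr even_two) h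
  have key := natCast_genusClassNumber_two_mul_eq_gBitCfgTwo redeiReichardt_fourTwoCard_classGroup_holds
    (vecCons q p : Fin (m + 1) → ℕ) (star_cons_prime hq hp) hP2 (star_cons_injective' hq4 hp5 hinj)
  rw [prod_star_cons] at key
  have hcfg : gBitCfgTwo (fun i => (vecCons q p : Fin (m + 1) → ℕ) i % 8)
      (fun a b => kroneckerBit ((vecCons q p : Fin (m + 1) → ℕ) b) ((vecCons q p : Fin (m + 1) → ℕ) a)) = 1 := by
    refine gBitCfgTwo_star_seven_eq_one _ ?_ ?_ _ (fun i => kroneckerBit (p i) q) ?_ ?_ ?_ hμ (a := a) ha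
    · simp [hq7]
    · intro i; simp [hp5 i]
    · intro i; simp
    · intro i
      have hpi2 : p i ≠ 2 := by have := hp5 i; omega
      have hpi4 : p i % 4 = 1 := by have := hp5 i; omega
      have hne : q ≠ p i := fun h => by have := hp5 i; omega
      simp only [cons_val_succ, cons_val_zero]
      rw [kroneckerBit_swap hq (hp i) hq2 hpi2 hne]
      simp [chi4Bit, hq4, hpi4]
    · intro i j hij
      simp only [cons_val_succ]
      exact hQR i j hij
  rw [hcfg] at key
  unfold gK
  exact ZMod.natCast_eq_one_iff_odd.mp key

/-- **`g(n)` is ODD on the tower type**: `q ≡ 3 (mod 4)`, at most one mark, and a mark exists unless `q ≡ 3 (mod 8)` (the two halves: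
`odd_gK_star` for `q ≡ 3`, `odd_gK_star_seven` for `q ≡ 7 (mod 8)`). [cite: LiMa2008, Thm. 0.4 (p. 280)] [cite: TianYuanZhang2017, §1 (p0002 L78–L82)] -/
theorem odd_gK_tower (hq : q.Prime) (hq4 : q % 4 = 3) (hp : ∀ i, (p i).Prime) (hp5 : ∀ i, p i % 8 = 5)
    (hinj : Function.Injective p) (hQR : ∀ i j, i ≠ j → kroneckerBit (p j) (p i) = 0)
    (hμ : ∀ i j, kroneckerBit (p i) q = 1 → kroneckerBit (p j) q = 1 → i = j)
    (hmark : q % 8 = 3 ∨ ∃ a, kroneckerBit (p a) q = 1) : Odd (gK (2 * (q * ∏ i, p i))) := by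
  by_cases hq3 : q % 8 = 3
  · exact odd_gK_star hq hq3 hp hp5 hinj hQR hμ
  · obtain ⟨a, ha⟩ := hmark.resolve_left hq3
    exact odd_gK_star_seven hq (by omega) hp hp5 hinj hQR hμ ha

/-! ## §4 The flat Θ-certificate and THEOREM B_∞′ (towers over both halves of `𝒮⁻`) -/

/-- **The flat Θ-certificate of the tower type** (`q ≡ 3 (mod 4)`): every inner coefficient `𝓛(e/d₀)` of the certificate equations is the
`𝓛` of an even block of the `pᵢ`, hence even; `s = g (mod 2)` is a certificate. CONDITIONAL on `h11`.
[cite: TianYuanZhang2017, §3.1 (p0011 L67–L73), Thm. 1.1] -/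
theorem thetaCert_tower (h11 : thm11_parity_of_scriptL) (hq : q.Prime) (hq4 : q % 4 = 3) (hp : ∀ i, (p i).Prime)
    (hp5 : ∀ i, p i % 8 = 5) (hinj : Function.Injective p) (hQR : ∀ i j, i ≠ j → kroneckerBit (p j) (p i) = 0)
    (D : GenusPointData (2 * (q * ∏ i, p i))) (hL : D.scriptLSpec) :
    ∀ e ∈ (2 * (q * ∏ i, p i)).divisors, e % 8 = 6 → (2 * (q * ∏ i, p i) / e) % 8 = 1 →
      (fun e => (gK e : ZMod 2)) e = (gK e : ZMod 2) +
        ∑ d₀ ∈ (recursionIndex e).filter (fun d₀ => d₀ % 8 = 6),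
          (D.scriptL (e / d₀) : ZMod 2) * (fun e => (gK e : ZMod 2)) d₀ := by
  have hsq := squarefree_star' hq hq4 hp hp5 hinj
  intro e he he6 _
  suffices h : ∑ d₀ ∈ (recursionIndex e).filter (fun d₀ => d₀ % 8 = 6),
      (D.scriptL (e / d₀) : ZMod 2) * (gK d₀ : ZMod 2) = 0 by
    simp only [h, add_zero]
  refine Finset.sum_eq_zero fun d₀ hd₀ => ?_
  obtain ⟨hd₀R, hd₀6⟩ := Finset.mem_filter.mp hd₀
  obtain ⟨hd₀e, -, h123, hgt⟩ := mem_recursionIndex_iff.mp hd₀R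
  have hen : e ∣ 2 * (q * ∏ i, p i) := Nat.dvd_of_mem_divisors he
  have hd₀dvd : d₀ ∣ e := Nat.dvd_of_mem_divisors hd₀e
  obtain ⟨z, hz, rfl⟩ := six_block_star' hq hq4 hp hp5 hinj hen he6
  obtain ⟨z', hz', rfl⟩ := six_block_star' hq hq4 hp hp5 hinj (hd₀dvd.trans hen) hd₀6
  have hqpos : 0 < 2 * q := by have := hq.pos; omega
  have hzz : z' ∣ z := by
    have h : 2 * q * z' ∣ 2 * q * z := by simpa only [mul_assoc] using hd₀dvd
    exact Nat.dvd_of_mul_dvd_mul_left hqpos h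
  have hquot : 2 * (q * z) / (2 * (q * z')) = z / z' := by
    rw [show 2 * (q * z) = (2 * q) * z by ring, show 2 * (q * z') = (2 * q) * z' by ring]
    exact Nat.mul_div_mul_left z z' hqpos
  rw [hquot] at h123 hgt ⊢
  have hw : z / z' ∣ ∏ i, p i := (Nat.div_dvd_of_dvd hzz).trans hz
  have hw1 : (z / z') % 8 = 1 := by
    rcases mod_eight_of_dvd_prod_five hp hp5 hinj hw with h | h <;> omega
  have hwn : z / z' ∈ (2 * (q * ∏ i, p i)).divisors :=
    Nat.mem_divisors.mpr ⟨hw.trans ((dvd_mul_left _ q).trans (dvd_mul_left _ 2)), hsq.ne_zero⟩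
  have hev := even_of_isScriptL_dvd_prod_five h11 hp hp5 hinj hQR hw hgt hw1 (hL _ hwn hgt)
  rw [(ZMod.intCast_eq_zero_iff_even (n := D.scriptL (z / z'))).mpr hev, zero_mul]

/-- **THEOREM B_∞′ (𝒮⁻-towers; route B, uniform in the number of prime factors).** Let `q ≡ 3 (mod 4)` and `p₁, …, p_m ≡ 5 (mod 8)` be
distinct primes with `(pⱼ/pᵢ) = +1` for `i ≠ j`, `(pᵢ/q) = −1` for AT MOST ONE `i`, and for at least one `i` unless `q ≡ 3 (mod 8)`;
`n = 2·q·p₁⋯p_m`. For every TYZ datum with the displayed printed sentences and rank `E_n(ℚ) ≤ 1` once `𝓛(n) ≠ 0`: `𝓛(n)` is ODD. At `m = 1`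
with the mark this is THEOREM B on ALL of `𝒮⁻`. CONDITIONAL on `h11` and the display; nothing asserted; NOT refereed.
[cite: TianYuanZhang2017, Thm. 3.5 (p0011 L94–L112), Thm. 3.6 (2) (J741), §3.1 (p0011 L67–L73), proof of Lemma 3.21 (J759), Thm. 1.1]
[cite: LiMa2008, Thm. 0.4] [cite: Monsky1990MockHeegner, p. 67 Remark (3)] -/
theorem odd_scriptL_tower (h11 : thm11_parity_of_scriptL) (hq : q.Prime) (hq4 : q % 4 = 3) (hp : ∀ i, (p i).Prime)
    (hp5 : ∀ i, p i % 8 = 5) (hinj : Function.Injective p) (hQR : ∀ i j, i ≠ j → kroneckerBit (p j) (p i) = 0)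
    (hμ : ∀ i j, kroneckerBit (p i) q = 1 → kroneckerBit (p j) q = 1 → i = j)
    (hmark : q % 8 = 3 ∨ ∃ a, kroneckerBit (p a) q = 1)
    (D : GenusPointData (2 * (q * ∏ i, p i))) (hD : D.Printed) (hG : D.CMPointGaloisPrinted)
    (hr :
      letI := isElliptic_congruentNumberCurve (squarefree_star' hq hq4 hp hp5 hinj).ne_zero
      D.scriptL (2 * (q * ∏ i, p i)) ≠ 0 → (congruentNumberCurve (2 * (q * ∏ i, p i))).mordellWeilRank ≤ 1) :
    Odd (D.scriptL (2 * (q * ∏ i, p i))) :=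
  odd_scriptL_of_thetaCert (squarefree_star' hq hq4 hp hp5 hinj) (star_mod_eight' hq4 hp hp5 hinj) D hD hG hr
    (thetaControlled_star' hq hq4 hp hp5 hinj) (fun e => (gK e : ZMod 2)) (thetaCert_tower h11 hq hq4 hp hp5 hinj hQR D hD.1)
    (ZMod.natCast_eq_one_iff_odd.mpr (odd_gK_tower hq hq4 hp hp5 hinj hQR hμ hmark))

/-- **Clause (a) on the 𝒮⁻-towers, from the Literature display ALONE** (+ TYZ Thm. 1.1): `ord_{s=1} L(E_n, s) = 1` for `n = 2·q·p₁⋯p_m` as in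
THEOREM B_∞′, every `m ≥ 0`. No GZK, no Selmer input. CONDITIONAL on {`tyz_cmPointGaloisData`, `thm11_parity_of_scriptL`}; nothing asserted.
[cite: TianYuanZhang2017, §1 (definition of 𝓛(n), p0002 L46–L75), Thm. 1.1, §3] -/
theorem analyticRank_eq_one_tower_of_cmPointGaloisData (hCM : tyz_cmPointGaloisData) (h11 : thm11_parity_of_scriptL)
    (hq : q.Prime) (hq4 : q % 4 = 3) (hp : ∀ i, (p i).Prime) (hp5 : ∀ i, p i % 8 = 5) (hinj : Function.Injective p)
    (hQR : ∀ i j, i ≠ j → kroneckerBit (p j) (p i) = 0) (hμ : ∀ i j, kroneckerBit (p i) q = 1 → kroneckerBit (p j) q = 1 → i = j)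
    (hmark : q % 8 = 3 ∨ ∃ a, kroneckerBit (p a) q = 1) :
    (congruentNumberCurve (2 * (q * ∏ i, p i))).analyticRank = 1 :=
  analyticRank_eq_one_of_thetaCert_of_cmPointGaloisData hCM (squarefree_star' hq hq4 hp hp5 hinj) (star_mod_eight' hq4 hp hp5 hinj)
    (thetaControlled_star' hq hq4 hp hp5 hinj) fun D hD _ =>
      ⟨fun e => (gK e : ZMod 2), thetaCert_tower h11 hq hq4 hp hp5 hinj hQR D hD.1,
        ZMod.natCast_eq_one_iff_odd.mpr (odd_gK_tower hq hq4 hp hp5 hinj hQR hμ hmark)⟩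

/-- **Output shape on the 𝒮⁻-towers**: an ODD integer `L` with `L² = 𝓛(n)²`, relative to {`tyz_cmPointGaloisData`, GZK, TYZ Thm. 1.1}.
CONDITIONAL; nothing asserted. [cite: TianYuanZhang2017, Thm. 3.5 and §3] -/
theorem exists_odd_isScriptL_tower_of_cmPointGaloisData (hCM : tyz_cmPointGaloisData)
    (hGZK : rank_eq_analyticRank_of_analyticRank_le_one) (h11 : thm11_parity_of_scriptL)
    (hq : q.Prime) (hq4 : q % 4 = 3) (hp : ∀ i, (p i).Prime) (hp5 : ∀ i, p i % 8 = 5) (hinj : Function.Injective p)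
    (hQR : ∀ i j, i ≠ j → kroneckerBit (p j) (p i) = 0) (hμ : ∀ i j, kroneckerBit (p i) q = 1 → kroneckerBit (p j) q = 1 → i = j)
    (hmark : q % 8 = 3 ∨ ∃ a, kroneckerBit (p a) q = 1) :
    ∃ L : ℤ, Odd L ∧ IsScriptL (2 * (q * ∏ i, p i)) L :=
  exists_odd_isScriptL_of_thetaCert_of_cmPointGaloisData hCM hGZK (squarefree_star' hq hq4 hp hp5 hinj)
    (star_mod_eight' hq4 hp hp5 hinj) (thetaControlled_star' hq hq4 hp hp5 hinj) fun D hD _ =>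
      ⟨fun e => (gK e : ZMod 2), thetaCert_tower h11 hq hq4 hp hp5 hinj hQR D hD.1,
        ZMod.natCast_eq_one_iff_odd.mpr (odd_gK_tower hq hq4 hp hp5 hinj hQR hμ hmark)⟩

end ThetaDescent

end Summit.BirchSwinnertonDyer.Rank1Residual.P2

end
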